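import Summits.HodgeConjecture.HodgeConjecture.Theorems.Ring2HypothesesDescentAbsoluteQbar
import Summits.HodgeConjecture.HodgeConjecture.Theorems.Ring2HypothesesDescentAbsolutePrimitiveDefect
import HarnessLib

/-!
# Ring 2 — hypotheses layer, descent axis: the `ℚ̄`-node and — with Voisin 2007 — the PARENT node ARE "Lefschetz-PRIMITIVE absolute
# Hodge classes of a fixed defect `k` on smooth projective varieties DEFINED OVER `ℚ̄` are algebraic" (modulo (N)+(E)+(c), resp. + c7)

HONEST FRAMING (page 1, verbatim the cell's standing line): **research route conditional on HC_CM; not a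
corollary; Q11.4-sentence-2 already refuted in dim ≥ 3.** Nothing in this file proves a case of the Hodge conjecture;
nothing discharges the binder of record b06 `Ring2.Hypotheses.AbsoluteHodgeImpliesAlgebraicAV`, its parent node
`AbsoluteHodgeImpliesAlgebraic` or the `ℚ̄`-variant `AbsoluteHodgeImpliesAlgebraicQbar` (all OPEN); the binder table's numbers do
not move. `HC_CM` (`Theses.RankFourFaces.CMAbelianHodge`) does not occur in this file; `HC_AV` is not asserted; Voisin's Prop. 1.2
(c7) is displayed as a hypothesis in §3 only.

Hodge ladder STAGE 3, `BINDER-OWNERS.md` row **b06**, seat `ring2-b06` (gen 72), sixth file of the gen: the PRIMITIVE sequel of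
`Ring2HypothesesDescentAbsoluteQbar` (fifth file: base change commutes with products, padding abelian varieties over `ℚ̄`, offset forms
of the `ℚ̄`-node, the parent node as the `ℚ̄`-middle slice under c7) along the third file's defect calculus
(`Ring2HypothesesDescentAbsolutePrimitiveDefect`: lift DOWN in defect, bare pull-back UP in defect). The class "isomorphic to some
`X₀ ⊗_ι ℂ`" is closed under `× E` for `E = E₀ ⊗_ι ℂ` an elliptic curve defined over `ℚ̄`, and primitive absolute Hodge classes, polarisation
classes and algebraic classes transport along isomorphisms, so the two inductions run inside the `ℚ̄`-world:

* §1 `forall_absoluteHodge_primitive_algebraic_of_iso_of_canonical` (transport of the primitive form along `Y ≅ Y'`);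
  `…qbar_of_defect_add…` / `…qbar_of_add_defect…` / `…qbar_of_defect…` (every defect from one, for varieties `≅ X₀ ⊗_ι ℂ`).
* §2 **`absoluteHodgeImpliesAlgebraicQbar_iff_primitive_defect_of_canonical k`: the `ℚ̄`-NODE `↔` "for every `ι`, every `Y₀/ℚ̄` with
  `Y₀ ⊗_ι ℂ` smooth projective of dimension `2q + k`, every polarisation class `θ` and every `q ≥ 2`, every θ-PRIMITIVE absolute Hodge class
  of `H^{2q}((Y₀ ⊗_ι ℂ)(ℂ); ℂ)` is algebraic"**, for EVERY `k` (modulo (N)+(E)+(c)).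
* §3 **WITH VOISIN (c7): `absoluteHodgeImpliesAlgebraic_iff_qbar_primitiveMiddle_of_voisin_of_canonical` — the PARENT node `↔` "for ONE
  embedding `ι`: Lefschetz-primitive absolute Hodge classes in the MIDDLE degree of smooth projective varieties DEFINED OVER `ℚ̄` (even
  dimension `≥ 4`) are algebraic"** — the intersection of all reductions of this gen (primitive ∧ middle ∧ defined over `ℚ̄`); the
  defect-`k` forms; row b06 from the same hypothesis. c7, (N), (E), (c) displayed, nothing asserted.

HONEST COLUMN. Nothing is discharged; «10 · 0» unchanged; the three nodes, `HC_AV` NOT asserted; no definition, no named fact, no sorry.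
COUNT ONCE: lift — ring2-b02; AH stability — gen 71; defect induction — ab-spread-1 XXVIII; Voisin's reduction — the tree's fact c7.
NOT claimed: that the primitive `ℚ̄`-middle form is strictly weaker; anything Galois-theoretic about the classes themselves.

References (bib keys): Voisin2007HodgeLoci (Prop. 1.2, Rem. 1.4), Deligne1982HodgeCycles (§2 Ex. 2.1 (c), (d) p. 16), CharlesSchnell2014Notes
(Def. 11.2.3, §11.2.2, Conj. 11.2.18), VoisinHodgeI2002 (§6.2.3 Def. 6.24, Thm. 6.25, Cor. 6.26), Kleiman1968AlgebraicCycles (§1.4 (1.4.6)),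
KerrPearlstein2011 (§3.1), Hartshorne1977 (II.3), GrothendieckTopology1969 (§1), MumfordAV1970 (§1, §4), SilvermanAEC2009 (III.3.6). -/

noncomputable section

set_option linter.dupNamespace false

open CategoryTheory CategoryTheory.Limits AlgebraicGeometry MonoidalCategory CartesianMonoidalCategory
open Literature.AlgebraicTopology.SingularHomology Literature.Geometry.Kaehler
open Literature.AlgebraicGeometry Literature.AlgebraicGeometry.Motives
open Literature.AlgebraicGeometry.HodgeTheory
open Summit.HodgeConjecture.HodgeConjecture.Theorems
open Summit.HodgeConjecture.HodgeConjecture.Ring2.Binders (map_mem_primitiveClasses primitiveLift_mem_primitiveClasses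
  mem_algebraicClasses_of_map_fst_mem)

namespace Summit.HodgeConjecture.HodgeConjecture.Ring2.Hypotheses

/-! ## §1 Transport and the two defect inductions inside the `ℚ̄`-world (modulo (N)+(E)+(c)) -/

section Induction

variable (ι : AlgebraicClosure ℚ →+* ℂ)

/-- **The primitive form transports along an isomorphism `e : Y ≅ Y'`** (modulo (N)+(E)): if for every polarisation class of `Y'` every
primitive absolute Hodge class of codimension `q` on `Y'` is algebraic, the same holds on `Y` — pull back along `e⁻¹ : Y' ⟶ Y`
(absolute Hodge: `absolutePullback_of_canonical`; primitive for the pulled-back polarisation: `map_mem_primitiveClasses`,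
`IsPolarizationClass.map_of_iso`) and transport algebraicity back (`mem_algebraicClasses_map_iff_of_iso`).
[cite: CharlesSchnell2014Notes, §11.2.2 (11.2.2)–(11.2.3)] [cite: VoisinHodgeI2002, §6.2.3 Def. 6.24] [cite: GrothendieckTopology1969, §1] -/
theorem forall_absoluteHodge_primitive_algebraic_of_iso_of_canonical (hN : chartConjugation_canonical)
    (hex : ∀ ⦃n : ℕ⦄ ⦃X : SchemeOver ℂ⦄, IsSmoothProjective n X →
      ∀ (σ : ℂ ≃+* ℂ) (p : ℕ) (c : complexBetti X (2 * p)), ∃ s, IsConjugateClass σ X (2 * p) c s)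
    {n : ℕ} {Y Y' : SchemeOver ℂ} (hY : IsSmoothProjective n Y) (hY' : IsSmoothProjective n Y') (e : Y ≅ Y') {q : ℕ}
    (h : ∀ ⦃θ' : complexBetti Y' 2⦄, IsPolarizationClass n Y' θ' → ∀ z' : complexBetti Y' (2 * q),
      IsAbsoluteHodgeClass n Y' q z' → z' ∈ primitiveClasses θ' n (2 * q) → z' ∈ algebraicClasses Y' q)
    ⦃θ : complexBetti Y 2⦄ (hθ : IsPolarizationClass n Y θ) (z : complexBetti Y (2 * q)) (hz : IsAbsoluteHodgeClass n Y q z)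
    (hprim : z ∈ primitiveClasses θ n (2 * q)) : z ∈ algebraicClasses Y q :=
  (mem_algebraicClasses_map_iff_of_iso e.symm).1
    (h (hθ.map_of_iso hY hY' e.symm) _ (absolutePullback_of_canonical hN hex hY' hY e.inv q z hz)
      (map_mem_primitiveClasses e.inv hprim))

/-- **`ℚ̄`: DOWN TO DEFECT `k` FROM DEFECT `k + e`** (granted (N), (E), (c)), for varieties isomorphic to some `X₀ ⊗_ι ℂ`: as the third
file's `forall_absoluteHodge_primitive_algebraic_of_defect_add_of_canonical`, the elliptic curve being `E₀ ⊗_ι ℂ` for `E₀/ℚ̄`, so that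
`X × E ≅ (X₀ ⊗ E₀) ⊗_ι ℂ` (`exists_abelianVariety_tensor_iso_baseChangeHom`). The hypothesis is NOT asserted.
[cite: Voisin2007HodgeLoci, Prop. 1.2 and Rem. 1.4] [cite: Deligne1982HodgeCycles, §2 Example 2.1 (c), (d) (p. 16)]
[cite: Kleiman1968AlgebraicCycles, §1.4 (1.4.6)] [cite: MumfordAV1970, §1 and §4] -/
theorem forall_absoluteHodge_primitive_algebraic_qbar_of_defect_add_of_canonical (hN : chartConjugation_canonical)
    (hex : ∀ ⦃n : ℕ⦄ ⦃X : SchemeOver ℂ⦄, IsSmoothProjective n X →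
      ∀ (σ : ℂ ≃+* ℂ) (p : ℕ) (c : complexBetti X (2 * p)), ∃ s, IsConjugateClass σ X (2 * p) c s)
    (h21c : deligne1982_lefschetz_absoluteHodge_iff) (k : ℕ)
    (hk : ∀ ⦃N : ℕ⦄ ⦃Y₀ : SchemeOver (AlgebraicClosure ℚ)⦄, IsSmoothProjective N ((baseChangeHom ι).obj Y₀) →
      ∀ ⦃θ : complexBetti ((baseChangeHom ι).obj Y₀) 2⦄, IsPolarizationClass N ((baseChangeHom ι).obj Y₀) θ →
        ∀ q : ℕ, 2 ≤ q → 2 * q + k = N → ∀ z : complexBetti ((baseChangeHom ι).obj Y₀) (2 * q),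
          IsAbsoluteHodgeClass N ((baseChangeHom ι).obj Y₀) q z → z ∈ primitiveClasses θ N (2 * q) →
            z ∈ algebraicClasses ((baseChangeHom ι).obj Y₀) q) :
    ∀ (e : ℕ) {X : SchemeOver ℂ} {n : ℕ}, IsSmoothProjective n X →
      ∀ {X₀ : SchemeOver (AlgebraicClosure ℚ)}, (X ≅ (baseChangeHom ι).obj X₀) →
        ∀ {η : complexBetti X 2}, IsPolarizationClass n X η → ∀ {p : ℕ}, 2 ≤ p → 2 * p + (k + e) = n →
          ∀ (c : complexBetti X (2 * p)), IsAbsoluteHodgeClass n X p c →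
            c ∈ primitiveClasses η n (2 * p) → c ∈ algebraicClasses X p := by
  intro e
  induction e with
  | zero =>
    intro X n hX X₀ eX η hη p h2 hn c hc hprim
    have hX₀ : IsSmoothProjective n ((baseChangeHom ι).obj X₀) := hX.of_iso eX
    exact forall_absoluteHodge_primitive_algebraic_of_iso_of_canonical hN hex hX hX₀ eX
      (fun θ' hθ' z' hz' hz'p ↦ hk hX₀ hθ' p h2 (by omega) z' hz' hz'p) hη c hc hprim
  | succ r ih =>
    intro X n hX X₀ eX η hη p h2 hn c hc hprim
    obtain ⟨E, Y₀, hE1, ⟨ψ⟩⟩ := exists_abelianVariety_tensor_iso_baseChangeHom ι eX 0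
    have hE : IsSmoothProjective E.dim E.X := AbelianVariety.isSmoothProjective_holds
    obtain ⟨κ, hκ⟩ := exists_isPolarizationClass hE
    have hX' : IsSmoothProjective (n + E.dim) (X ⊗ E.X) := IsSmoothProjective.tensor_holds hX hE
    have hz := ih hX' ψ (isPolarizationClass_boxSum hX hE hη hκ) (p := p + 1) (by omega) (by omega) _
      (isAbsoluteHodgeClass_primitiveLift_of_canonical hN hex h21c hX hη E hκ hc (k + r + 1))
      (primitiveLift_mem_primitiveClasses E η κ hE1 (r := k + r) (by omega) hprim)
    exact mem_algebraicClasses_of_primitiveLift_mem_of_ne_zero hX E hE1 η (ne_zero_of_isPolarizationClass hE hκ (by omega))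
      (by exact_mod_cast Nat.succ_ne_zero (k + r)) hz

/-- **`ℚ̄`: UP TO DEFECT `d + e` FROM DEFECT `d`** (granted (N), (E)), for varieties isomorphic to some `X₀ ⊗_ι ℂ`: as the third file's
`forall_absoluteHodge_primitive_algebraic_of_add_defect_of_canonical` (bare pull-back to `X × E`, `E = E₀ ⊗_ι ℂ`; slice descent). The
hypothesis is NOT asserted. [cite: Voisin2007HodgeLoci, Prop. 1.2 and Rem. 1.4] [cite: CharlesSchnell2014Notes, §11.2.2 (11.2.2)–(11.2.3)]
[cite: VoisinHodgeI2002, §6.2.3 Def. 6.24 and Cor. 6.26] [cite: SilvermanAEC2009, III.3.6] -/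
theorem forall_absoluteHodge_primitive_algebraic_qbar_of_add_defect_of_canonical (hN : chartConjugation_canonical)
    (hex : ∀ ⦃n : ℕ⦄ ⦃X : SchemeOver ℂ⦄, IsSmoothProjective n X →
      ∀ (σ : ℂ ≃+* ℂ) (p : ℕ) (c : complexBetti X (2 * p)), ∃ s, IsConjugateClass σ X (2 * p) c s) (d : ℕ) :
    ∀ (e : ℕ), (∀ ⦃N : ℕ⦄ ⦃Y₀ : SchemeOver (AlgebraicClosure ℚ)⦄, IsSmoothProjective N ((baseChangeHom ι).obj Y₀) →
        ∀ ⦃θ : complexBetti ((baseChangeHom ι).obj Y₀) 2⦄, IsPolarizationClass N ((baseChangeHom ι).obj Y₀) θ →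
          ∀ q : ℕ, 2 ≤ q → 2 * q + (d + e) = N → ∀ z : complexBetti ((baseChangeHom ι).obj Y₀) (2 * q),
            IsAbsoluteHodgeClass N ((baseChangeHom ι).obj Y₀) q z → z ∈ primitiveClasses θ N (2 * q) →
              z ∈ algebraicClasses ((baseChangeHom ι).obj Y₀) q) →
      ∀ {X : SchemeOver ℂ} {n : ℕ}, IsSmoothProjective n X →
        ∀ {X₀ : SchemeOver (AlgebraicClosure ℚ)}, (X ≅ (baseChangeHom ι).obj X₀) →
          ∀ {η : complexBetti X 2}, IsPolarizationClass n X η → ∀ {p : ℕ}, 2 ≤ p → 2 * p + d = n →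
            ∀ (c : complexBetti X (2 * p)), IsAbsoluteHodgeClass n X p c →
              c ∈ primitiveClasses η n (2 * p) → c ∈ algebraicClasses X p := by
  intro e
  induction e generalizing d with
  | zero =>
    intro hk X n hX X₀ eX η hη p h2 hn c hc hprim
    have hX₀ : IsSmoothProjective n ((baseChangeHom ι).obj X₀) := hX.of_iso eX
    exact forall_absoluteHodge_primitive_algebraic_of_iso_of_canonical hN hex hX hX₀ eX
      (fun θ' hθ' z' hz' hz'p ↦ hk hX₀ hθ' p h2 (by omega) z' hz' hz'p) hη c hc hprim
  | succ r ih =>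
    intro hk X n hX X₀ eX η hη p h2 hn c hc hprim
    obtain ⟨E, Y₀, hE1, ⟨ψ⟩⟩ := exists_abelianVariety_tensor_iso_baseChangeHom ι eX 0
    have hE : IsSmoothProjective E.dim E.X := AbelianVariety.isSmoothProjective_holds
    obtain ⟨κ, hκ⟩ := exists_isPolarizationClass hE
    have hX' : IsSmoothProjective (n + E.dim) (X ⊗ E.X) := IsSmoothProjective.tensor_holds hX hE
    have hκκ : cupProduct (rfl : 2 + 2 = 4) κ κ = 0 := by
      haveI := subsingleton_complexBetti hE (k := 4) (by omega)
      exact Subsingleton.elim _ _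
    refine mem_algebraicClasses_of_map_fst_mem hX E (ih (d + 1) (fun N Y₀ hY θ hθ q hq hqN ↦ hk hY hθ q hq (by omega)) hX' ψ
      (isPolarizationClass_boxSum hX hE hη hκ) h2 (by omega) _ (absolutePullback_of_canonical hN hex hX' hX (fst X E.X) p c hc)
      (map_fst_mem_primitiveClasses_boxSum_of_sq_eq_zero η hκκ (by omega) hprim))

/-- **`ℚ̄`: EVERY DEFECT FROM ONE DEFECT** (granted (N), (E), (c)), for varieties isomorphic to some `X₀ ⊗_ι ℂ` (`d ≥ k`: lift `d − k`
times; `d < k`: pull back `k − d` times). The hypothesis is NOT asserted. [cite: Voisin2007HodgeLoci, Prop. 1.2 and Rem. 1.4]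
[cite: Deligne1982HodgeCycles, §2 Example 2.1 (c), (d) (p. 16)] [cite: KerrPearlstein2011, §3.1] -/
theorem forall_absoluteHodge_primitive_algebraic_qbar_of_defect_of_canonical (hN : chartConjugation_canonical)
    (hex : ∀ ⦃n : ℕ⦄ ⦃X : SchemeOver ℂ⦄, IsSmoothProjective n X →
      ∀ (σ : ℂ ≃+* ℂ) (p : ℕ) (c : complexBetti X (2 * p)), ∃ s, IsConjugateClass σ X (2 * p) c s)
    (h21c : deligne1982_lefschetz_absoluteHodge_iff) (k : ℕ)
    (hk : ∀ ⦃N : ℕ⦄ ⦃Y₀ : SchemeOver (AlgebraicClosure ℚ)⦄, IsSmoothProjective N ((baseChangeHom ι).obj Y₀) →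
      ∀ ⦃θ : complexBetti ((baseChangeHom ι).obj Y₀) 2⦄, IsPolarizationClass N ((baseChangeHom ι).obj Y₀) θ →
        ∀ q : ℕ, 2 ≤ q → 2 * q + k = N → ∀ z : complexBetti ((baseChangeHom ι).obj Y₀) (2 * q),
          IsAbsoluteHodgeClass N ((baseChangeHom ι).obj Y₀) q z → z ∈ primitiveClasses θ N (2 * q) →
            z ∈ algebraicClasses ((baseChangeHom ι).obj Y₀) q)
    (d : ℕ) {X : SchemeOver ℂ} {n : ℕ} (hX : IsSmoothProjective n X) {X₀ : SchemeOver (AlgebraicClosure ℚ)}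
    (eX : X ≅ (baseChangeHom ι).obj X₀) {η : complexBetti X 2} (hη : IsPolarizationClass n X η) {p : ℕ} (hp : 2 ≤ p)
    (hd : 2 * p + d = n) (c : complexBetti X (2 * p)) (hc : IsAbsoluteHodgeClass n X p c) (hprim : c ∈ primitiveClasses η n (2 * p)) :
    c ∈ algebraicClasses X p := by
  by_cases hkd : k ≤ d
  · obtain ⟨e, rfl⟩ := Nat.exists_eq_add_of_le hkd
    exact forall_absoluteHodge_primitive_algebraic_qbar_of_defect_add_of_canonical ι hN hex h21c k hk e hX eX hη hp hd c hc hprim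
  · obtain ⟨e, rfl⟩ := Nat.exists_eq_add_of_lt (not_le.1 hkd)
    exact forall_absoluteHodge_primitive_algebraic_qbar_of_add_defect_of_canonical ι hN hex d (e + 1)
      (fun N Y₀ hY θ hθ q hq hqN ↦ hk hY hθ q hq (by omega)) hX eX hη hp hd c hc hprim

end Induction

/-! ## §2 The `ℚ̄`-node at a fixed primitive defect `k` (modulo (N)+(E)+(c)) -/

section QbarNode

/-- **THE `ℚ̄`-NODE `↔` "for every `ι`, every `Y₀/ℚ̄` with `Y₀ ⊗_ι ℂ` smooth projective, every polarisation class `θ` and every `q ≥ 2`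
with `dim = 2q + k`, every θ-PRIMITIVE absolute Hodge class of `H^{2q}((Y₀ ⊗_ι ℂ)(ℂ); ℂ)` is algebraic" — FOR EVERY FIXED `k`** (modulo
(N)+(E)+(c)). `⟹` restriction; `⟸`: per `ι` and `X₀`, gen 71's per-variety reduction to `[H]`-primitive absolute Hodge classes below the
middle (`forall_absoluteHodge_algebraic_of_primitive_of_canonical`), each handled by §1 at its defect. Neither side is asserted.
[cite: Voisin2007HodgeLoci, Prop. 1.2 and Rem. 1.4] [cite: CharlesSchnell2014Notes, §11.2.5 Conj. 11.2.18]
[cite: VoisinHodgeI2002, §6.2.3 Def. 6.24, Thm. 6.25 and Cor. 6.26] [cite: KerrPearlstein2011, §3.1] -/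
theorem absoluteHodgeImpliesAlgebraicQbar_iff_primitive_defect_of_canonical (hN : chartConjugation_canonical)
    (hex : ∀ ⦃n : ℕ⦄ ⦃X : SchemeOver ℂ⦄, IsSmoothProjective n X →
      ∀ (σ : ℂ ≃+* ℂ) (p : ℕ) (c : complexBetti X (2 * p)), ∃ s, IsConjugateClass σ X (2 * p) c s)
    (h21c : deligne1982_lefschetz_absoluteHodge_iff) (k : ℕ) :
    AbsoluteHodgeImpliesAlgebraicQbar ↔
      ∀ (ι : AlgebraicClosure ℚ →+* ℂ) ⦃N : ℕ⦄ ⦃Y₀ : SchemeOver (AlgebraicClosure ℚ)⦄,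
        IsSmoothProjective N ((baseChangeHom ι).obj Y₀) →
          ∀ ⦃θ : complexBetti ((baseChangeHom ι).obj Y₀) 2⦄, IsPolarizationClass N ((baseChangeHom ι).obj Y₀) θ →
            ∀ q : ℕ, 2 ≤ q → 2 * q + k = N → ∀ z : complexBetti ((baseChangeHom ι).obj Y₀) (2 * q),
              IsAbsoluteHodgeClass N ((baseChangeHom ι).obj Y₀) q z → z ∈ primitiveClasses θ N (2 * q) →
                z ∈ algebraicClasses ((baseChangeHom ι).obj Y₀) q := by
  refine ⟨fun h ι N Y₀ hY θ _ q _ _ z hz _ ↦ h ι hY q z hz, fun h ι n X₀ hX p c hc ↦ ?_⟩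
  obtain ⟨Λ⟩ := nonempty_hardLefschetzNFold_holds n _ hX
  refine forall_absoluteHodge_algebraic_of_primitive_of_canonical hN hex h21c hX Λ ?_ p c hc
  intro q hq hq2 a ha haAH
  exact forall_absoluteHodge_primitive_algebraic_qbar_of_defect_of_canonical ι hN hex h21c k (h ι) (n - 2 * q) hX (Iso.refl _)
    Λ.isPolarizationClass hq (by omega) a haAH ha

end QbarNode

/-! ## §3 With Voisin 2007 (c7): the parent node is the primitive `ℚ̄`-middle slice (modulo c7 + (N)+(E)+(c)) -/

section Voisin

/-- **THE PARENT NODE `↔` "for ONE embedding `ι`: θ-PRIMITIVE absolute Hodge classes of codimension `q ≥ 2` on smooth projective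
`Y₀ ⊗_ι ℂ` of dimension `2q + k`, `Y₀` DEFINED OVER `ℚ̄`, are algebraic" — for every fixed `k`** (modulo Voisin's Prop. 1.2 = c7 and
(N)+(E)+(c)): `⟸` = §1 on every `X₀ ⊗_ι ℂ`, then Voisin's reduction `voisin2007_hodgeConjecture_absolute_of_qbar` (displayed as `hV`).
Nothing asserted. [cite: Voisin2007HodgeLoci, Prop. 1.2 and Rem. 1.4] [cite: CharlesSchnell2014Notes, §11.2.5 Conj. 11.2.18]
[cite: KerrPearlstein2011, §3.1] -/
theorem absoluteHodgeImpliesAlgebraic_iff_qbar_primitive_defect_of_voisin_of_canonical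
    (hV : voisin2007_hodgeConjecture_absolute_of_qbar) (hN : chartConjugation_canonical)
    (hex : ∀ ⦃n : ℕ⦄ ⦃X : SchemeOver ℂ⦄, IsSmoothProjective n X →
      ∀ (σ : ℂ ≃+* ℂ) (p : ℕ) (c : complexBetti X (2 * p)), ∃ s, IsConjugateClass σ X (2 * p) c s)
    (h21c : deligne1982_lefschetz_absoluteHodge_iff) (ι : AlgebraicClosure ℚ →+* ℂ) (k : ℕ) :
    AbsoluteHodgeImpliesAlgebraic ↔
      ∀ ⦃N : ℕ⦄ ⦃Y₀ : SchemeOver (AlgebraicClosure ℚ)⦄, IsSmoothProjective N ((baseChangeHom ι).obj Y₀) →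
        ∀ ⦃θ : complexBetti ((baseChangeHom ι).obj Y₀) 2⦄, IsPolarizationClass N ((baseChangeHom ι).obj Y₀) θ →
          ∀ q : ℕ, 2 ≤ q → 2 * q + k = N → ∀ z : complexBetti ((baseChangeHom ι).obj Y₀) (2 * q),
            IsAbsoluteHodgeClass N ((baseChangeHom ι).obj Y₀) q z → z ∈ primitiveClasses θ N (2 * q) →
              z ∈ algebraicClasses ((baseChangeHom ι).obj Y₀) q := by
  refine ⟨fun h N Y₀ hY θ _ q _ _ z hz _ ↦ h hY q z hz, fun h n X hX p c hc ↦ hV ι ?_ hX p c hc⟩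
  intro n' X₀ hX₀ p' c' hc'
  obtain ⟨Λ⟩ := nonempty_hardLefschetzNFold_holds n' _ hX₀
  refine forall_absoluteHodge_algebraic_of_primitive_of_canonical hN hex h21c hX₀ Λ ?_ p' c' hc'
  intro q hq hq2 a ha haAH
  exact forall_absoluteHodge_primitive_algebraic_qbar_of_defect_of_canonical ι hN hex h21c k h (n' - 2 * q) hX₀ (Iso.refl _)
    Λ.isPolarizationClass hq (by omega) a haAH ha

/-- **THE PARENT NODE `↔` "for ONE embedding `ι`: Lefschetz-PRIMITIVE absolute Hodge classes in the MIDDLE degree `H^{2m}` of smooth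
projective `Y₀ ⊗_ι ℂ` of even dimension `2m ≥ 4`, `Y₀` DEFINED OVER `ℚ̄`, every hard Lefschetz datum, are algebraic"** (the case `k = 0`,
modulo c7 + (N)+(E)+(c)) — the intersection of this gen's reductions of Charles–Schnell Conj. 11.2.18: PRIMITIVE, MIDDLE degree, and
DEFINED OVER `ℚ̄`. Nothing asserted. [cite: Voisin2007HodgeLoci, Prop. 1.2 and Rem. 1.4] [cite: CharlesSchnell2014Notes, §11.2.5 Conj. 11.2.18]
[cite: VoisinHodgeI2002, §6.2.3 Def. 6.24 and Thm. 6.25] [cite: KerrPearlstein2011, §3.1] -/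
theorem absoluteHodgeImpliesAlgebraic_iff_qbar_primitiveMiddle_of_voisin_of_canonical
    (hV : voisin2007_hodgeConjecture_absolute_of_qbar) (hN : chartConjugation_canonical)
    (hex : ∀ ⦃n : ℕ⦄ ⦃X : SchemeOver ℂ⦄, IsSmoothProjective n X →
      ∀ (σ : ℂ ≃+* ℂ) (p : ℕ) (c : complexBetti X (2 * p)), ∃ s, IsConjugateClass σ X (2 * p) c s)
    (h21c : deligne1982_lefschetz_absoluteHodge_iff) (ι : AlgebraicClosure ℚ →+* ℂ) :
    AbsoluteHodgeImpliesAlgebraic ↔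
      ∀ ⦃N : ℕ⦄ ⦃Y₀ : SchemeOver (AlgebraicClosure ℚ)⦄, IsSmoothProjective N ((baseChangeHom ι).obj Y₀) →
        ∀ (Λ : HardLefschetzNFold N ((baseChangeHom ι).obj Y₀)) (m : ℕ), 2 ≤ m → N = 2 * m →
          ∀ z : complexBetti ((baseChangeHom ι).obj Y₀) (2 * m), IsAbsoluteHodgeClass N ((baseChangeHom ι).obj Y₀) m z →
            z ∈ primitiveClasses Λ.hyperplaneClass N (2 * m) → z ∈ algebraicClasses ((baseChangeHom ι).obj Y₀) m := by
  refine (absoluteHodgeImpliesAlgebraic_iff_qbar_primitive_defect_of_voisin_of_canonical hV hN hex h21c ι 0).trans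
    ⟨fun h N Y₀ hY Λ m hm hN2 z hz hprim ↦ h hY Λ.isPolarizationClass m hm (by omega) z hz hprim,
      fun h N Y₀ hY θ hθ q hq hqN z hz hprim ↦ ?_⟩
  obtain ⟨Λ', rfl⟩ := hθ.exists_hardLefschetzNFold hY
  exact h hY Λ' q hq (by omega) z hz hprim

/-- **Row b06 from the primitive `ℚ̄`-middle hypothesis** (modulo c7 + (N)+(E)+(c)): through the parent node. Nothing asserted; row b06
NOT discharged. [cite: Voisin2007HodgeLoci, Prop. 1.2 and Rem. 1.4] [cite: Deligne1982HodgeCycles, Intro pp. 5–7] -/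
theorem absoluteHodgeImpliesAlgebraicAV_of_qbar_primitiveMiddle_of_voisin_of_canonical
    (hV : voisin2007_hodgeConjecture_absolute_of_qbar) (hN : chartConjugation_canonical)
    (hex : ∀ ⦃n : ℕ⦄ ⦃X : SchemeOver ℂ⦄, IsSmoothProjective n X →
      ∀ (σ : ℂ ≃+* ℂ) (p : ℕ) (c : complexBetti X (2 * p)), ∃ s, IsConjugateClass σ X (2 * p) c s)
    (h21c : deligne1982_lefschetz_absoluteHodge_iff) (ι : AlgebraicClosure ℚ →+* ℂ)
    (h : ∀ ⦃N : ℕ⦄ ⦃Y₀ : SchemeOver (AlgebraicClosure ℚ)⦄, IsSmoothProjective N ((baseChangeHom ι).obj Y₀) →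
      ∀ (Λ : HardLefschetzNFold N ((baseChangeHom ι).obj Y₀)) (m : ℕ), 2 ≤ m → N = 2 * m →
        ∀ z : complexBetti ((baseChangeHom ι).obj Y₀) (2 * m), IsAbsoluteHodgeClass N ((baseChangeHom ι).obj Y₀) m z →
          z ∈ primitiveClasses Λ.hyperplaneClass N (2 * m) → z ∈ algebraicClasses ((baseChangeHom ι).obj Y₀) m) :
    AbsoluteHodgeImpliesAlgebraicAV :=
  absoluteHodgeImpliesAlgebraicAV_of_all
    ((absoluteHodgeImpliesAlgebraic_iff_qbar_primitiveMiddle_of_voisin_of_canonical hV hN hex h21c ι).2 h)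

/-- **The same keyed to (N), (G), (c), c7**. None of the four facts is asserted. [cite: Voisin2007HodgeLoci, Prop. 1.2 and Rem. 1.4]
[cite: CharlesSchnell2014Notes, §11.2.2 (11.2.1)–(11.2.3) and Conj. 11.2.18] -/
theorem absoluteHodgeImpliesAlgebraic_iff_qbar_primitiveMiddle_of_voisin_of_grothendieck
    (hV : voisin2007_hodgeConjecture_absolute_of_qbar) (hN : chartConjugation_canonical)
    (hG : grothendieck_comparison_realize_surjective) (h21c : deligne1982_lefschetz_absoluteHodge_iff)
    (ι : AlgebraicClosure ℚ →+* ℂ) :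
    AbsoluteHodgeImpliesAlgebraic ↔
      ∀ ⦃N : ℕ⦄ ⦃Y₀ : SchemeOver (AlgebraicClosure ℚ)⦄, IsSmoothProjective N ((baseChangeHom ι).obj Y₀) →
        ∀ (Λ : HardLefschetzNFold N ((baseChangeHom ι).obj Y₀)) (m : ℕ), 2 ≤ m → N = 2 * m →
          ∀ z : complexBetti ((baseChangeHom ι).obj Y₀) (2 * m), IsAbsoluteHodgeClass N ((baseChangeHom ι).obj Y₀) m z →
            z ∈ primitiveClasses Λ.hyperplaneClass N (2 * m) → z ∈ algebraicClasses ((baseChangeHom ι).obj Y₀) m :=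
  absoluteHodgeImpliesAlgebraic_iff_qbar_primitiveMiddle_of_voisin_of_canonical hV hN (exists_isConjugateClass_even_of_grothendieck hG)
    h21c ι

end Voisin

/-! ## Audit: nothing is decided here

No theorem above concludes `AbsoluteHodgeImpliesAlgebraic`, `AbsoluteHodgeImpliesAlgebraicQbar`, `AbsoluteHodgeImpliesAlgebraicAV`,
`HC_AV` or `HC_CM` outright: every statement carries the undischarged hypotheses (N), (E)/(G), (c) and, in §3, c7 (named facts of the
tree, displayed, never asserted) together with a primitive `ℚ̄`-slice hypothesis. Axiom closures: the three standard axioms. -/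

#print axioms Summit.HodgeConjecture.HodgeConjecture.Ring2.Hypotheses.absoluteHodgeImpliesAlgebraicQbar_iff_primitive_defect_of_canonical
#print axioms Summit.HodgeConjecture.HodgeConjecture.Ring2.Hypotheses.absoluteHodgeImpliesAlgebraic_iff_qbar_primitiveMiddle_of_voisin_of_canonical

end Summit.HodgeConjecture.HodgeConjecture.Ring2.Hypotheses

end
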